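import Literature.AlgebraicGeometry.Frobenioids.Prop55SubRatStdSlot
import Literature.AlgebraicGeometry.Frobenioids.PadicFrobenioidRational
import HarnessLib

/-!
# Frobenioids II, Theorem 1.2 (i) "If `D` is of FSMFF-type, then `C` is of rationally standard type" AT THE
# parameters of [FrdI] Def. 4.5 (iii): everything but the Frobenius-compact object of `(C^un-tr)^birat` — PROOF

Mochizuki, *The geometry of Frobenioids II: poly-Frobenioids*, Kyushu J. Math. **62** (2008) 401–460, Thm. 1.2 (i),
kurims text p. 9 ("If `D` is of FSMFF-type, then `C` is of rationally standard type"), proof p. 9 ("since the image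
monoids of this homomorphism are assumed to be nonzero, and `Φ` is monoprime [cf. Example 1.1, (ii)], it follows
immediately that `C` is of quasi-Frobenius-trivial and [strictly] rational type"); [FrdI] Def. 4.5 (iii) p. 86.
[cite: MochizukiFrdII2008, Thm 1.2 (i) p.9]

PROOF-ONLY (seat abc-iut-L6-t10 gen 2, row M17 at THE data). The typed slot `PadicFrd.Thm12_i_standard d V`
(abc-iut-L1-t4) is a SCHEMA over a vocabulary binding `V`; `Thm12_i_standard_of_inputs` (landed) reduces it, for
bindings implied by Def. 4.5 (iii) at parameters `R`, to three inputs on `R`. Here `R` is THE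
`PreFrobenioid.rsParams hF (PrimarySupp)` of the `p`-adic Frobenioid of a datum `d` with `Φ`, `B` monoids on `D`:
* `padic_isRational_rsParams` — every object is rational w.r.t. THE `(C^birat, Supp)` (`PadicFrd.Datum.isRational`,
  support axiom by `Iff.rfl`);
* `padic_isOfRationallyStandardType_rsParams_iff` — over a base of FSMFF-type, **rationally standard w.r.t. THE
  parameters ⟺ `(C^un-tr)^birat` admits a Frobenius-compact object** (whose data-level core `endTrivial` is landed);
* `Thm12_i_standard_rsParams_of_frobCompact` — the typed slot at every binding implied by THE parameters, from that
  one remaining input.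
No definitions; nothing here bears on [IUTchIII] or asserts anything about abc.
-/

noncomputable section

namespace Literature.AlgebraicGeometry.Frobenioids

open CategoryTheory Opposite Function

namespace PadicFrd

namespace Datum

universe v u

variable {D : Type u} [Category.{v} D] {p : ℕ} [Fact p.Prime] (d : Datum D p)

/-- **Every object of the `p`-adic Frobenioid is rational w.r.t. THE `(C^birat, Supp)`** (`Φ` monoprime with
nonzero image of `B`). [cite: MochizukiFrdII2008, Thm 1.2 (i) p.9] -/
theorem padic_isRational_rsParams (h : d.IsMonoidData) (A : d.frobenioid) :
    PreFrobenioidData.IsRational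
      (PreFrobenioid.rsParams (d.isFrobenioid_of_isMonoidData h) fun a 𝔭 => PrimarySupp a 𝔭).B
      (PreFrobenioid.rsParams (d.isFrobenioid_of_isMonoidData h) fun a 𝔭 => PrimarySupp a 𝔭).Supp A :=
  d.isRational (d.isFrobenioid_of_isMonoidData h)
    (PreFrobenioid.hasBiratSquares_of_isFrobenioid (d.isFrobenioid_of_isMonoidData h)) _
    (fun _ _ _ => Iff.rfl) A

/-- **Over a base of FSMFF-type, the `p`-adic Frobenioid is of rationally standard type w.r.t. THE parameters iff
`(C^un-tr)^birat` admits a Frobenius-compact object** — birationally Frobenius-normalized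
(`thm12_isOfBiratFrobeniusNormalizedType`), rational (above) and standard (`thm12_isOfStandardType`) being PROVED.
[cite: MochizukiFrdII2008, Thm 1.2 (i) p.9] -/
theorem padic_isOfRationallyStandardType_rsParams_iff (h : d.IsMonoidData) (hD : IsOfFSMFFType D) :
    (ModelFrobenioid.data d.Φ d.B d.divB).IsOfRationallyStandardType
        (PreFrobenioid.rsParams (d.isFrobenioid_of_isMonoidData h) fun a 𝔭 => PrimarySupp a 𝔭) ↔
      ∃ Y : (PreFrobenioid.rsParams (d.isFrobenioid_of_isMonoidData h) fun a 𝔭 => PrimarySupp a 𝔭).BU.Birat,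
        (PreFrobenioid.rsParams (d.isFrobenioid_of_isMonoidData h) fun a 𝔭 => PrimarySupp a 𝔭).BU.ops.IsFrobeniusCompact
          Y := by
  rw [d.isOfRationallyStandardType_data_iff h hD]
  exact ⟨fun hr => hr.2.2, fun hC =>
    ⟨d.thm12_isOfBiratFrobeniusNormalizedType h _, d.padic_isRational_rsParams h, hC⟩⟩

/-- **Thm. 1.2 (i), third sentence, at THE parameters**: the typed slot `Thm12_i_standard d V` holds for every
binding `V` whose rationally-standard field is implied by Def. 4.5 (iii) at THE parameters, GIVEN a
Frobenius-compact object of `(C^un-tr)^birat`. [cite: MochizukiFrdII2008, Thm 1.2 (i) p.9] -/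
theorem Thm12_i_standard_rsParams_of_frobCompact (h : d.IsMonoidData) (V : Thm12Vocab d)
    (hV : (ModelFrobenioid.data d.Φ d.B d.divB).IsOfRationallyStandardType
        (PreFrobenioid.rsParams (d.isFrobenioid_of_isMonoidData h) fun a 𝔭 => PrimarySupp a 𝔭) →
      V.IsOfRationallyStandardType)
    (hC : ∃ Y : (PreFrobenioid.rsParams (d.isFrobenioid_of_isMonoidData h) fun a 𝔭 => PrimarySupp a 𝔭).BU.Birat,
      (PreFrobenioid.rsParams (d.isFrobenioid_of_isMonoidData h) fun a 𝔭 => PrimarySupp a 𝔭).BU.ops.IsFrobeniusCompact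
        Y) :
    Thm12_i_standard d V :=
  d.Thm12_i_standard_of_inputs h V _ hV (d.thm12_isOfBiratFrobeniusNormalizedType h _)
    (d.padic_isRational_rsParams h) hC

end Datum

end PadicFrd

end Literature.AlgebraicGeometry.Frobenioids

end
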